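import Mathlib
import Summits.Ventures.HodgeRepro.LitRank
import Summits.Ventures.HodgeRepro.LitRankMaiArith

/-!
# LitRankMai — Murty's lower bound `rank(K,S) ≥ (p−1)²α/p` for simple Galois CM-types, PROVED
(Mai 1989, Proposition 2)

Blind cell `pub-hodge-repro`, seat lit-2 (gen 5).  Discharges the printed fact `Mai1989_prop2_Murty`
of `LitRank.lean`: Liem Mai, *Lower bounds for the ranks of CM types*, J. Number Theory 32 (1989)
192–202 (store `paper:doi-10-1016-0022-314x-89-90025-5`), p.195 (p0004:L7–L19):

"The following result is due to Murty [5], giving another lower bound for the rank in terms of the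
prime divisors of [K:ℚ].  PROPOSITION 2.  Let K/ℚ be a Galois extension, with G = Gal(K/ℚ), (K,S) be a
simple CM type.  Then rank(K,S) ≥ max_p {(p−1)²α/p : p odd prime and p^α ∥ [K:ℚ]/2}."
([5] = V. K. Murty, *Nondegenerate CM types*, unpublished notes, 1984 — p0011:L23.)

**The proof as printed (p0004:L20–L48), followed step by step.**  "Consider φ : ℤ[K] → ℤ[K′],
[α] ↦ Σ_{s∈S} [α s].  Let Y = Im φ; then τ : G → GL(Y) given by τ(g)·φ([α]) = φ([gα]) is an injective
group homomorphism (can be checked directly).  Since Y is a free ℤ-module, Y ≅ ℤ^r, in which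
r = rank Im φ, thus GL(Y) ≅ GL(ℤ^r) ≅ GL_r(ℤ).  If q is a sufficiently large prime, then τ induces an
embedding [into GL_r(ℤ/qℤ)].  In particular, let d = [K:ℚ]/2; then d ∣ |GL_r(ℤ/qℤ)| = …"

* `CMTriple.lat` = Y, the ℤ-span of the translates `g τ` in `ℚ[G]` (`τ = Σ_{s∈S̃} s`, Kubota's element);
  `CMTriple.finrank_lat`: its ℤ-rank is `rank(K,S)` (a ℤ-basis of `Y` is ℚ-linearly independent and
  spans `ℚ[G]·τ`).
* `CMTriple.repHom`: the action `τ(g)` = left multiplication by `g` on `Y`; `CMTriple.repHom_injective`: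
  faithful when the type is simple and `H = 1` ("can be checked directly": `g τ = τ` forces
  `g S̃ = S̃`, hence `g ∈ H = 1`).
* `CMTriple.toGLInt`, `CMTriple.toGLMod q`: the integer matrices in a ℤ-basis and their reduction mod
  `q`; `CMTriple.toGLMod_injective`: injective as soon as the prime `q` exceeds every entry of the
  matrices `τ(g) − 1` ("q sufficiently large" — no Minkowski lemma needed);
  `CMTriple.card_dvd_prod`: `|G| ∣ |GL_r(F_q)| = ∏_{i<r} (q^r − q^i)` (Lagrange + `Matrix.card_GL_field`).
* `Mai1989_prop2_Murty_holds`: with `q` a prime primitive root mod `p²` larger than that bound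
  (`exists_prime_primitiveRoot`: Dirichlet + cyclicity of `(ℤ/p²)ˣ`), the valuation count of
  `LitRankMaiArith.lean` (`Murty.murty_bound`) gives `(p−1)² α ≤ p·rank`.

The hypothesis `¬ p^(α+1) ∣ d` of the typed statement ("p^α ∥ d") is not needed — the bound holds for
every `α` with `p^α ∣ d`.  No new named fact (D-0026); everything below is proved.  Imports:
`LitRank` (the fact and `LitRankDef`'s vocabulary) and `LitRankMaiArith` (the arithmetic).
-/

open scoped Pointwise

namespace HodgeRepro.Lit2
namespace CMTriple

variable {G : Type*} [Group G] [Fintype G] [DecidableEq G] (T : CMTriple G)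

/-! ### Part A of Murty's argument (Mai 1989 p.195): the lattice `Y = Im φ` and the faithful
representation `τ : G → GL(Y)`. -/

/-- The ℤ-lattice `Y = ℤ[G]·τ` spanned by the Galois translates `g τ` of Kubota's element
(Mai p.195: "Let Y = Im φ; then … Y ≅ ℤ^r, in which r = rank Im φ"). -/
noncomputable def lat : Submodule ℤ (MonoidAlgebra ℚ G) :=
  Submodule.span ℤ (Set.range fun g : G => MonoidAlgebra.single g (1 : ℚ) * T.tau)

omit [Fintype G] [DecidableEq G] in
/-- Every translate `g τ` lies in the lattice. -/
theorem translate_mem_lat (g : G) : MonoidAlgebra.single g (1 : ℚ) * T.tau ∈ T.lat :=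
  Submodule.subset_span ⟨g, rfl⟩

omit [Fintype G] [DecidableEq G] in
/-- `τ` itself lies in the lattice (the translate at `g = 1`). -/
theorem tau_mem_lat : T.tau ∈ T.lat := by
  have := T.translate_mem_lat 1
  rwa [← MonoidAlgebra.one_def, one_mul] at this

/-- The lattice is finitely generated (by the finitely many translates). -/
instance lat_finite : Module.Finite ℤ T.lat :=
  Module.Finite.iff_fg.mpr (Submodule.fg_span (Set.finite_range _))

omit [Fintype G] [DecidableEq G] in
/-- The lattice sits inside the ℚ-span of the translates, `ℚ[G]·τ`. -/
theorem lat_le_range : T.lat ≤ (LinearMap.range (LinearMap.mulRight ℚ T.tau)).restrictScalars ℤ := by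
  rw [lat, Submodule.span_le]
  rintro _ ⟨g, rfl⟩
  exact ⟨MonoidAlgebra.single g 1, rfl⟩

omit [DecidableEq G] in
/-- `rank_ℤ Y = rank(K,S)` (Mai p.195 "Y ≅ ℤ^r, in which r = rank Im φ"). -/
theorem finrank_lat : Module.finrank ℤ T.lat = T.rank := by
  classical
  let b := Module.Free.chooseBasis ℤ T.lat
  let v : Module.Free.ChooseBasisIndex ℤ T.lat → MonoidAlgebra ℚ G := fun i => (b i : MonoidAlgebra ℚ G)
  have hli : LinearIndependent ℤ v := b.linearIndependent.map' T.lat.subtype T.lat.ker_subtype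
  have hliQ : LinearIndependent ℚ v := (LinearIndependent.iff_fractionRing ℤ ℚ).mp hli
  have hlat : T.lat = Submodule.span ℤ (Set.range v) := by
    have h := congrArg (Submodule.map T.lat.subtype) b.span_eq
    rw [Submodule.map_span, Submodule.map_subtype_top] at h
    have hv : Set.range v = T.lat.subtype '' Set.range b := by
      ext y
      simp only [Set.mem_range, Set.mem_image, v, Submodule.coe_subtype]
      constructor
      · rintro ⟨i, rfl⟩; exact ⟨b i, ⟨i, rfl⟩, rfl⟩
      · rintro ⟨z, ⟨i, rfl⟩, rfl⟩; exact ⟨i, rfl⟩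
    rw [hv]
    exact h.symm
  have hspan : Submodule.span ℚ (Set.range v) = LinearMap.range (LinearMap.mulRight ℚ T.tau) := by
    apply le_antisymm
    · rw [Submodule.span_le]
      rintro _ ⟨i, rfl⟩
      exact T.lat_le_range (b i).2
    · rw [T.range_mulRight_tau, Submodule.span_le]
      rintro _ ⟨g, rfl⟩
      have hmem := T.translate_mem_lat g
      rw [hlat] at hmem
      exact Submodule.span_le_restrictScalars ℤ ℚ _ hmem
  rw [rank, ← hspan, finrank_span_eq_card hliQ, Module.finrank_eq_card_chooseBasisIndex]

omit [Fintype G] [DecidableEq G] in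
/-- Left multiplication by `g` preserves the lattice. -/
theorem mulLeft_mem_lat (g : G) {x : MonoidAlgebra ℚ G} (hx : x ∈ T.lat) :
    MonoidAlgebra.single g (1 : ℚ) * x ∈ T.lat := by
  induction hx using Submodule.span_induction with
  | mem x hx =>
    obtain ⟨h, rfl⟩ := hx
    rw [← mul_assoc, MonoidAlgebra.single_mul_single, one_mul]
    exact T.translate_mem_lat _
  | zero => simp
  | add x y _ _ hx hy => rw [mul_add]; exact T.lat.add_mem hx hy
  | smul a x _ hx =>
    rw [← Int.cast_smul_eq_zsmul ℚ, mul_smul_comm, Int.cast_smul_eq_zsmul]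
    exact T.lat.smul_mem a hx

/-- The action of `g ∈ G` on the lattice `Y` (Mai p.195: "τ(g)·φ([α]) = φ([gα])"). -/
noncomputable def rep (g : G) : T.lat →ₗ[ℤ] T.lat where
  toFun x := ⟨MonoidAlgebra.single g (1 : ℚ) * x, T.mulLeft_mem_lat g x.2⟩
  map_add' x y := by ext; simp [mul_add]
  map_smul' a x := by
    ext
    simp only [Submodule.coe_smul, RingHom.id_apply]
    rw [← Int.cast_smul_eq_zsmul ℚ, mul_smul_comm, Int.cast_smul_eq_zsmul]

omit [Fintype G] [DecidableEq G] in
/-- `rep g` is left multiplication by `g` on the underlying elements of `ℚ[G]`. -/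
@[simp] theorem rep_apply_coe (g : G) (x : T.lat) :
    ((T.rep g x : T.lat) : MonoidAlgebra ℚ G) = MonoidAlgebra.single g (1 : ℚ) * x := rfl

/-- The representation `τ : G → GL(Y)`, as a monoid homomorphism into `End_ℤ(Y)`. -/
noncomputable def repHom : G →* (T.lat →ₗ[ℤ] T.lat) where
  toFun := T.rep
  map_one' := by
    ext x
    simp [← MonoidAlgebra.one_def]
  map_mul' g h := by
    ext x
    simp [Module.End.mul_apply, mul_assoc]

omit [Fintype G] [DecidableEq G] in
/-- `repHom g = rep g`. -/
@[simp] theorem repHom_apply (g : G) : T.repHom g = T.rep g := rfl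

omit [Group G] [Fintype G] in
/-- The indicator element of a set of group elements, evaluated. -/
theorem sum_single_coeff (A : Finset G) (x : G) :
    (∑ s ∈ A, MonoidAlgebra.single s (1 : ℚ)).coeff x = if x ∈ A then 1 else 0 := by
  rw [MonoidAlgebra.coeff_sum, Finsupp.finsetSum_apply]
  simp only [MonoidAlgebra.coeff_single, Finsupp.single_apply]
  rw [Finset.sum_ite_eq' A x (fun _ => (1 : ℚ))]

omit [Fintype G] in
/-- For a simple CM-type with `H = 1`, the representation is faithful (Mai p.195: "is an injective
group homomorphism (can be checked directly)"). -/
theorem repHom_injective (hH : T.H = ⊥) (hs : T.IsSimple) : Function.Injective T.repHom := by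
  rw [injective_iff_map_eq_one]
  intro g hg
  have h1 : T.rep g ⟨T.tau, T.tau_mem_lat⟩ = ⟨T.tau, T.tau_mem_lat⟩ := by
    rw [← T.repHom_apply, hg]; rfl
  have h2 : MonoidAlgebra.single g (1 : ℚ) * T.tau = T.tau := congrArg Subtype.val h1
  have h3 : g • T.S = T.S := by
    rw [T.single_mul_tau] at h2
    unfold tau at h2
    ext x
    have := congrArg (fun f : MonoidAlgebra ℚ G => f.coeff x) h2
    simp only [sum_single_coeff] at this
    by_cases hx : x ∈ g • T.S <;> by_cases hy : x ∈ T.S <;> simp_all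
  have := hs g h3
  rw [hH] at this
  exact Subgroup.mem_bot.mp this

/-! ### Part C: integer matrices, reduction mod a large prime `q`, `|G| ∣ |GL_r(F_q)|`
(Mai p.195: "Y ≅ ℤ^r … GL(Y) ≅ GL_r(ℤ). If q is a sufficiently large prime, then τ induces an
embedding G ↪ GL_r(ℤ/qℤ). In particular … d ∣ |GL_r(ℤ/qℤ)|"). -/

/-- A ℤ-basis of `Y` indexed by `Fin (rank(K,S))`. -/
noncomputable def bas : Module.Basis (Fin T.rank) ℤ T.lat :=
  (Module.finBasis ℤ T.lat).reindex (finCongr T.finrank_lat)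

/-- `τ : G → GL_r(ℤ)` in the basis `bas`. -/
noncomputable def toGLInt : G →* GL (Fin T.rank) ℤ :=
  (Units.mapEquiv (LinearMap.toMatrixAlgEquiv T.bas).toMulEquiv).toMonoidHom.comp
    T.repHom.toHomUnits

/-- The matrix representation is faithful for a simple type with `H = 1`. -/
theorem toGLInt_injective (hH : T.H = ⊥) (hs : T.IsSimple) : Function.Injective T.toGLInt := by
  intro g g' h
  apply T.repHom_injective hH hs
  have h1 := (Units.mapEquiv (LinearMap.toMatrixAlgEquiv T.bas).toMulEquiv).injective h
  have h2 := congrArg Units.val h1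
  simpa [MonoidHom.coe_toHomUnits] using h2

/-- The absolute value of the `(i,j)` entry of `τ(g) - 1`. -/
noncomputable def entryAbs (x : G × Fin T.rank × Fin T.rank) : ℕ :=
  ((T.toGLInt x.1 : Matrix (Fin T.rank) (Fin T.rank) ℤ) x.2.1 x.2.2 -
    (1 : Matrix (Fin T.rank) (Fin T.rank) ℤ) x.2.1 x.2.2).natAbs

/-- The largest absolute value of an entry of `τ(g) - 1`, over all `g`. -/
noncomputable def entryBound : ℕ := Finset.sup Finset.univ T.entryAbs

omit [DecidableEq G] in
/-- Every entry of every `τ(g) − 1` is bounded by `entryBound` in absolute value. -/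
theorem entryAbs_le_entryBound (x : G × Fin T.rank × Fin T.rank) :
    T.entryAbs x ≤ T.entryBound :=
  Finset.le_sup (f := T.entryAbs) (Finset.mem_univ x)

/-- Reduction mod `q`: `G → GL_r(ℤ/qℤ)`. -/
noncomputable def toGLMod (q : ℕ) : G →* GL (Fin T.rank) (ZMod q) :=
  (Matrix.GeneralLinearGroup.map (Int.castRingHom (ZMod q))).comp T.toGLInt

/-- For `q > entryBound`, reduction mod `q` is still injective on `G` (Mai p.195 "If q is a
sufficiently large prime, then τ induces an embedding"). -/
theorem toGLMod_injective (hH : T.H = ⊥) (hs : T.IsSimple) (q : ℕ) (hq : T.entryBound < q) :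
    Function.Injective (T.toGLMod q) := by
  rw [injective_iff_map_eq_one]
  intro g hg
  apply T.toGLInt_injective hH hs
  rw [map_one]
  ext i j
  have h1 := congrArg (fun u : GL (Fin T.rank) (ZMod q) =>
    (u : Matrix (Fin T.rank) (Fin T.rank) (ZMod q)) i j) hg
  simp only [toGLMod, MonoidHom.comp_apply, Units.val_one] at h1
  rw [Matrix.GeneralLinearGroup.map_apply] at h1
  have h2 : ((T.toGLInt g : Matrix (Fin T.rank) (Fin T.rank) ℤ) i j : ZMod q) =
      ((1 : Matrix (Fin T.rank) (Fin T.rank) ℤ) i j : ZMod q) := by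
    rw [eq_intCast] at h1
    rw [h1, Matrix.one_apply, Matrix.one_apply]
    split_ifs <;> simp
  rw [ZMod.intCast_eq_intCast_iff_dvd_sub] at h2
  have h3 := T.entryAbs_le_entryBound (g, i, j)
  unfold entryAbs at h3
  have h4 : (1 : Matrix (Fin T.rank) (Fin T.rank) ℤ) i j -
      (T.toGLInt g : Matrix (Fin T.rank) (Fin T.rank) ℤ) i j = 0 := by
    apply Int.eq_zero_of_abs_lt_dvd h2
    rw [abs_sub_comm, Int.abs_eq_natAbs]
    exact_mod_cast lt_of_le_of_lt h3 hq
  have := sub_eq_zero.mp h4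
  exact this.symm

/-- `|G|` divides `|GL_r(F_q)|` for every prime `q > entryBound` (Mai p.195 "d ∣ |GL_r(ℤ/qℤ)|"). -/
theorem card_dvd_prod (hH : T.H = ⊥) (hs : T.IsSimple) (q : ℕ) [Fact q.Prime]
    (hq : T.entryBound < q) :
    Fintype.card G ∣ ∏ i : Fin T.rank, (q ^ T.rank - q ^ (i : ℕ)) := by
  have h := Subgroup.card_dvd_of_injective _ (T.toGLMod_injective hH hs q hq)
  rw [Matrix.card_GL_field, ZMod.card, Nat.card_eq_fintype_card] at h
  exact h

end CMTriple

open Murty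

/-- A prime `q > N` which is a primitive root mod `p²` (`p` an odd prime), with the three facts
Murty's valuation count uses (Dirichlet's theorem on primes in arithmetic progressions +
the cyclicity of `(ℤ/p²)ˣ`). -/
theorem exists_prime_primitiveRoot (p : ℕ) [hp : Fact p.Prime] (hodd : Odd p) (N : ℕ) :
    ∃ q : ℕ, q.Prime ∧ N < q ∧ ¬ p ∣ q ∧ (∀ i : ℕ, p ∣ q ^ i - 1 → (p - 1) ∣ i) ∧
      padicValNat p (q ^ (p - 1) - 1) = 1 := by
  haveI : NeZero (p ^ 2) := ⟨pow_ne_zero 2 hp.out.ne_zero⟩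
  have hp2 : p ≠ 2 := by rintro rfl; exact (Nat.not_odd_iff_even.mpr even_two) hodd
  haveI : IsCyclic (ZMod (p ^ 2))ˣ := ZMod.isCyclic_units_of_prime_pow p hp.out hp2 2
  obtain ⟨g, hg⟩ := IsCyclic.exists_generator (α := (ZMod (p ^ 2))ˣ)
  obtain ⟨q, hqN, hqp, hq⟩ :=
    Nat.forall_exists_prime_gt_and_eq_mod (q := p ^ 2) (a := (g : ZMod (p ^ 2))) g.isUnit N
  obtain ⟨h0, h1, h2⟩ := primitiveRoot_facts p hodd g hg q hq
  exact ⟨q, hqp, hqN, h0, h1, h2⟩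

/-- **Mai 1989, Proposition 2 (Murty), holds**: for a Galois `K/ℚ` (`H = 1`) and a simple CM-type,
`rank(K,S) ≥ (p-1)²α/p` for every odd prime `p` with `p^α ∣ [K:ℚ]/2`.  Proof = Mai p.195 verbatim:
`G` acts faithfully on the lattice `Y = ℤ[G]τ ≅ ℤ^r` (`CMTriple.repHom_injective`), hence embeds in
`GL_r(ℤ/qℤ)` for a large prime `q` (`CMTriple.toGLMod_injective`), so `p^α ∣ d ∣ |GL_r(F_q)|`
(`CMTriple.card_dvd_prod`); with `q` a primitive root mod `p²` the `p`-adic valuation of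
`|GL_r(F_q)|` is `ω + v_p(ω!)`, `ω = ⌊r/(p-1)⌋` (`Murty.sum_padicValNat_eq`), whence
`(p-1)² α ≤ p r` (`Murty.murty_bound`).  The hypothesis `¬ p^(α+1) ∣ d` ("p^α ∥ d") is not used. -/
theorem Mai1989_prop2_Murty_holds : Mai1989_prop2_Murty := by
  intro G _ _ _ T hH hs p α hp hp2 hdvd _
  haveI := Fact.mk hp
  have hodd : Odd p := hp.odd_of_ne_two hp2
  obtain ⟨q, hqp, hqN, hpq, h1, h2⟩ := exists_prime_primitiveRoot p hodd T.entryBound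
  haveI := Fact.mk hqp
  have hcard := T.card_dvd_prod hH hs q hqN
  have hdim : T.dim ∣ Fintype.card G :=
    Dvd.intro_left 2 (by rw [T.dim_eq_card_S_of_H_eq_bot hH, T.two_mul_card_S])
  have hpa : p ^ α ∣ ∏ i : Fin T.rank, (q ^ T.rank - q ^ (i : ℕ)) := (hdvd.trans hdim).trans hcard
  have hmain := murty_bound p hodd q hqp.two_le hpq h1 h2 T.rank α hpa
  have hc : ((p : ℚ) - 1) ^ 2 * α ≤ (T.rank : ℚ) * p := by
    have h' : (((p - 1) ^ 2 * α : ℕ) : ℚ) ≤ ((p * T.rank : ℕ) : ℚ) := by exact_mod_cast hmain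
    rw [Nat.cast_mul, Nat.cast_mul, Nat.cast_pow, Nat.cast_sub hp.one_lt.le, Nat.cast_one] at h'
    linarith
  rw [div_le_iff₀ (by exact_mod_cast hp.pos)]
  exact hc

end HodgeRepro.Lit2
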